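import Summits.NavierStokesRegularity.NavierStokesRegularity.Theorems.StableStrataDoorWindowLimit

/-!
# StableStrataDoorSchema — S26 «StableStrataDoor» (ε-STABLE STRATA: the open-neighbourhood principle K-stab(Φ,𝔖) and the
ε-AXISYMMETRIC Type-I door, uniform in the axis), part 4/6: THE SCHEMA K-stab(Φ, 𝔖), typed and PROVED (§8)

§8 the abstract schema over a window observable `Φ : (ℝ³ → ℝ³) → ℝ≥0∞` and a stratum `𝔖 : Set (ℝ³ → ℝ³)`:
(H1) `IsWindowLsc Φ` (zoom-closedness), (H2) `SpreadsTo Φ 𝔖 ν` (analytic spread), (H3) `StratumLiouville 𝔖 D` (stratum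
Type-I Liouville); the texts `PhysSmall` / `ProfSmall` / K1(Φ) `StratumZoom` / R(Φ) `StratumResidue` / T(Φ) `StratumDoorAt`;
and the three PROVED theorems `stratumZoom_of_lsc` (K1(Φ) for every zoom-closed `Φ`, via `stratum_windowLimit`),
`stratumResidue_of_liouville` ((H1)+(H2)+(H3) ⇒ ε-stable stratum) and `stratumDoorAt_of_liouville` (the ε-door at every `M`).

Door family of LADDER-NS N0 (local Type-I window doors S20–S26); THEOREMS-ONLY landing of the nsreg-p1 design
`run/shared/lean/pub/ns-regularity-ideate/ns-regularity-ideate-p1/r25/Sketch26.lean` (ROUND-25.md; sha16 bf87a99673b3e6ef,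
farm rc 0 / 0 sorry), split by section into `StableStrataDoor{Defs, WindowLimit, AxiStability, Schema, Instances, Uniform}`,
texts verbatim, namespace = file stem.  No route, no items (DIRECTOR-NS standing #32 (2); landing lane ns-door-S23-p1).
WHAT THIS IS NOT: not NS regularity (Clay (A)) and not a dent in `NoTypeII` (stmt-0056) — every statement lives INSIDE the
Type-I class; not the swirl hard cores (no Type-I-free statement); not the Type-I Liouville conjecture — only window-open
neighbourhoods of strata where it is already a theorem; `ε` comes from compactness and is NOT explicit.
-/

noncomputable section

set_option linter.dupNamespace false

namespace Summit.NavierStokesRegularity.NavierStokesRegularity.Theorems.StableStrataDoorSchema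

open MeasureTheory Set Function Filter Topology TopologicalSpace Metric
open scoped RealInnerProductSpace NNReal ENNReal Topology Pointwise
open Literature.Analysis Literature.Analysis.FluidPDE
open Summit.NavierStokesRegularity.NavierStokesRegularity.Theorems.PoloidalWindowDoorPoloidalWindowRigidityWindow
open Summit.NavierStokesRegularity.NavierStokesRegularity.Theorems.ZoomReturnDoorDefs
open Summit.NavierStokesRegularity.NavierStokesRegularity.Theorems.ZoomReturnDoorWindowLimit
open Summit.NavierStokesRegularity.NavierStokesRegularity.Theorems.ZoomReturnDoorRemovableFactors
open Summit.NavierStokesRegularity.NavierStokesRegularity.Theorems.ZoomReturnDoorGlue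
open Summit.NavierStokesRegularity.NavierStokesRegularity.Theorems.ZoomReturnDoorExtraction
open Summit.NavierStokesRegularity.NavierStokesRegularity.Theorems.ZoomReturnDoorClassicalLimit
open Summit.NavierStokesRegularity.NavierStokesRegularity.Theorems.StableStrataDoorDefs
open Summit.NavierStokesRegularity.NavierStokesRegularity.Theorems.StableStrataDoorWindowLimit

/-! ## §8 THE SCHEMA K-stab(Φ, 𝔖) — typed and PROVED: every zoom-closed window observable `Φ` whose exact vanishing
on one window spreads (by slice analyticity) to an analytic STRATUM `𝔖` carrying a Type-I Liouville theorem yields an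
`ε`-door with `ε(ν, M, Φ)` fixed before the solution.  Data: `Φ : (ℝ³ → ℝ³) → ℝ≥0∞` a functional of the window slice
field (the window `U` is baked into `Φ`), `𝔖 : Set (ℝ³ → ℝ³)` the stratum of slice fields. -/

section Schema

variable (Φ : (EuclideanSpace ℝ (Fin 3) → EuclideanSpace ℝ (Fin 3)) → ℝ≥0∞)
  (𝔖 : Set (EuclideanSpace ℝ (Fin 3) → EuclideanSpace ℝ (Fin 3)))

/-- **(H1) ZOOM-CLOSEDNESS**: `Φ` is lower semicontinuous along pointwise limits of continuous slice fields. -/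
def IsWindowLsc : Prop :=
  ∀ (Fn : ℕ → EuclideanSpace ℝ (Fin 3) → EuclideanSpace ℝ (Fin 3)) (F : EuclideanSpace ℝ (Fin 3) → EuclideanSpace ℝ (Fin 3)),
    (∀ n, Continuous (Fn n)) → Continuous F → (∀ y, Tendsto (fun n => Fn n y) atTop (𝓝 (F y))) →
    Φ F ≤ liminf (fun n => Φ (Fn n)) atTop

/-- **(H2) ANALYTIC SPREAD** at viscosity `ν`: exact vanishing of `Φ` on the window field of an ANALYTIC slice puts the
whole slice into the stratum. -/
def SpreadsTo (ν : ℝ) : Prop :=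
  ∀ (v : ℝ → EuclideanSpace ℝ (Fin 3) → EuclideanSpace ℝ (Fin 3)) (s : ℝ), s < 0 →
    AnalyticOnNhd ℝ (v s) Set.univ → Φ (profileWindowField ν v s) = 0 → v s ∈ 𝔖

/-- **(H3) STRATUM TYPE-I LIOUVILLE** with decay constant `D` (`ν = 1` gauge): a classical solution on `(−∞,0) × ℝ³` with
`|V| ≤ D/(|x| + √−t)` all of whose slices lie in the stratum vanishes. -/
def StratumLiouville (D : ℝ) : Prop :=
  ∀ (V : ℝ → EuclideanSpace ℝ (Fin 3) → EuclideanSpace ℝ (Fin 3)) (q : ℝ → EuclideanSpace ℝ (Fin 3) → ℝ),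
    IsClassicalNSSolutionOn (Set.Iio 0) 1 0 V q → HasTypeIDecay D V → (∀ τ < 0, V τ ∈ 𝔖) → ∀ τ < 0, ∀ x, V τ x = 0

/-- physical side: `Φ` EVENTUALLY `ε`-small on the scale-normalised velocity around `(x₀, T)`. -/
def PhysSmall (T : ℝ) (x₀ : EuclideanSpace ℝ (Fin 3)) (u : ℝ → EuclideanSpace ℝ (Fin 3) → EuclideanSpace ℝ (Fin 3))
    (ε : ℝ) : Prop :=
  ∀ᶠ t in nhdsWithin T (Set.Iio T), Φ (physWindowField T x₀ u t) ≤ ENNReal.ofReal ε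

/-- profile side: `Φ` `ε`-small at every profile time. -/
def ProfSmall (ν ε : ℝ) (v : ℝ → EuclideanSpace ℝ (Fin 3) → EuclideanSpace ℝ (Fin 3)) : Prop :=
  ∀ s < 0, Φ (profileWindowField ν v s) ≤ ENNReal.ofReal ε

/-- K1(Φ): the zoom transports eventual `ε`-smallness to the profile. -/
def StratumZoom : Prop :=
  ∀ (ν T : ℝ), 0 < ν → 0 < T → ∀ (u : ℝ → EuclideanSpace ℝ (Fin 3) → EuclideanSpace ℝ (Fin 3))
    (p : ℝ → EuclideanSpace ℝ (Fin 3) → ℝ), IsClassicalNSSolutionOn (Set.Ico 0 T) ν 0 u p →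
    IsLerayHopfOn T ν 0 (u 0) u → HasRapidSpatialDecay (u 0) →
    ∀ (x₀ : EuclideanSpace ℝ (Fin 3)) (ρ M : ℝ), 0 < ρ →
    (∀ t ∈ Set.Ico 0 T, T - ρ ^ 2 < t → ∀ x ∈ Metric.ball x₀ ρ, ‖u t x‖ * (‖x - x₀‖ + Real.sqrt (ν * (T - t))) ≤ M) →
    ¬ IsBackwardBoundedAt u T x₀ →
    ∃ (C : ℝ) (v : ℝ → EuclideanSpace ℝ (Fin 3) → EuclideanSpace ℝ (Fin 3)), IsDoorProfile C v ∧
      HasTypeIDecay (M / ν) v ∧ IsBackwardSingularPoint v 0 ∧ ∀ ε : ℝ, PhysSmall Φ T x₀ u ε → ProfSmall Φ ν ε v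

/-- R(Φ): the `ε`-STABLE STRATUM at `(ν, D)`. -/
def StratumResidue (ν D : ℝ) : Prop :=
  ∃ ε : ℝ, 0 < ε ∧
    ∀ (u : ℝ → EuclideanSpace ℝ (Fin 3) → EuclideanSpace ℝ (Fin 3)) (p : ℝ → EuclideanSpace ℝ (Fin 3) → ℝ),
    IsClassicalNSSolutionOn (Set.Iio 0) 1 0 u p → HasTypeIDecay D u → ProfSmall Φ ν ε u → ∀ t < 0, ∀ x, u t x = 0

/-- T(Φ): the `ε`-DOOR at constants `(ν, M)`. -/
def StratumDoorAt (ν M : ℝ) : Prop :=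
  ∃ ε : ℝ, 0 < ε ∧ ∀ (T : ℝ), 0 < T →
    ∀ (u : ℝ → EuclideanSpace ℝ (Fin 3) → EuclideanSpace ℝ (Fin 3)) (p : ℝ → EuclideanSpace ℝ (Fin 3) → ℝ),
    IsClassicalNSSolutionOn (Set.Ico 0 T) ν 0 u p → IsLerayHopfOn T ν 0 (u 0) u → HasRapidSpatialDecay (u 0) →
    ∀ (x₀ : EuclideanSpace ℝ (Fin 3)) (ρ : ℝ), 0 < ρ →
    (∀ t ∈ Set.Ico 0 T, T - ρ ^ 2 < t → ∀ x ∈ Metric.ball x₀ ρ, ‖u t x‖ * (‖x - x₀‖ + Real.sqrt (ν * (T - t))) ≤ M) →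
    PhysSmall Φ T x₀ u ε → IsBackwardBoundedAt u T x₀

variable {Φ 𝔖}

/-- profile-side smallness is zoom invariant (for every `Φ`). -/
theorem profSmall_nsRescale {ν ε : ℝ} {u : ℝ → EuclideanSpace ℝ (Fin 3) → EuclideanSpace ℝ (Fin 3)}
    (h : ProfSmall Φ ν ε u) {lam : ℝ} (hlam : 0 < lam) : ProfSmall Φ ν ε (nsRescale lam u) := by
  intro s hs
  rw [profileWindowField_nsRescale ν u hlam s]
  exact h (lam ^ 2 * s) (mul_neg_of_pos_of_neg (by positivity) hs)

/-- continuity of a slice of a door-class / classical field from joint continuity on `(−∞,0) × ℝ³`. -/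
theorem continuous_slice_of_continuousOn {v : ℝ → EuclideanSpace ℝ (Fin 3) → EuclideanSpace ℝ (Fin 3)}
    (hcont : ContinuousOn (uncurry v) (Set.Iio (0 : ℝ) ×ˢ Set.univ)) {s : ℝ} (hs : s < 0) : Continuous (v s) :=
  hcont.comp_continuous (continuous_const.prodMk continuous_id) fun _ => ⟨hs, mem_univ _⟩

/-- **GENERIC WINDOW LIMIT (K1(Φ) core)**: along a velocity zoom with continuous limit slice, eventual `ε`-smallness of a
ZOOM-CLOSED `Φ` passes to the profile window field at every profile time. -/
theorem stratum_windowLimit (hlsc : IsWindowLsc Φ) {ν T : ℝ} {u : ℝ → EuclideanSpace ℝ (Fin 3) → EuclideanSpace ℝ (Fin 3)}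
    {p : ℝ → EuclideanSpace ℝ (Fin 3) → ℝ} {x₀ : EuclideanSpace ℝ (Fin 3)}
    {v : ℝ → EuclideanSpace ℝ (Fin 3) → EuclideanSpace ℝ (Fin 3)} {lam : ℕ → ℝ}
    (hν : 0 < ν) (hT : 0 < T) (hcl : IsClassicalNSSolutionOn (Ico 0 T) ν 0 u p)
    (hlam : ∀ j, 0 < lam j) (hlam0 : Tendsto lam atTop (𝓝 0))
    (hconv : ∀ s < 0, ∀ y,
      Tendsto (fun j => (lam j / ν) • u (T + lam j ^ 2 * s / ν) (x₀ + lam j • y)) atTop (𝓝 (v s y)))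
    {ε : ℝ} (hsmall : PhysSmall Φ T x₀ u ε) {s : ℝ} (hs : s < 0) (hvs : Continuous (v s)) :
    Φ (profileWindowField ν v s) ≤ ENNReal.ofReal ε := by
  have hns : 0 < -s := neg_pos.2 hs
  obtain ⟨t, ht⟩ : ∃ t : ℕ → ℝ, ∀ j, t j = T + lam j ^ 2 * s / ν := ⟨_, fun j => rfl⟩
  have hTt : ∀ j, T - t j = lam j ^ 2 * (-s) / ν := fun j => by rw [ht j]; ring
  have hc : ∀ j, 0 < lam j ^ 2 * (-s) / ν := fun j => div_pos (mul_pos (pow_pos (hlam j) 2) hns) hν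
  have hc0 : Tendsto (fun j => lam j ^ 2 * (-s) / ν) atTop (𝓝 0) := by
    simpa using ((hlam0.pow 2).mul_const (-s)).div_const ν
  have htT : Tendsto t atTop (𝓝[<] T) := by
    refine tendsto_nhdsWithin_iff.2 ⟨?_, Eventually.of_forall fun j => ?_⟩
    · have h1 : Tendsto (fun j => T - lam j ^ 2 * (-s) / ν) atTop (𝓝 (T - 0)) :=
        tendsto_const_nhds.sub hc0
      rw [sub_zero] at h1
      refine h1.congr fun j => ?_
      rw [ht j]; ring
    · show t j < T
      have h1 := hc j
      rw [← hTt j] at h1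
      linarith
  have hev : ∀ᶠ j in atTop, t j ∈ Set.Ioo 0 T := htT.eventually (Ioo_mem_nhdsLT hT)
  obtain ⟨j₀, hj₀⟩ := eventually_atTop.1 hev
  have hshift : Tendsto (fun j : ℕ => j + j₀) atTop atTop := tendsto_add_atTop_nat j₀
  have hsmallj : ∀ᶠ j in atTop, Φ (physWindowField T x₀ u (t (j + j₀))) ≤ ENNReal.ofReal ε :=
    (htT.comp hshift).eventually hsmall
  set σ : ℝ := Real.sqrt (-s) / Real.sqrt ν with hσ
  have hsq : ∀ j, Real.sqrt (T - t j) = lam j * σ := by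
    intro j
    rw [hTt j, hσ, Real.sqrt_div' _ hν.le, Real.sqrt_mul (pow_nonneg (hlam j).le 2), Real.sqrt_sq (hlam j).le]
    ring
  set W : ℕ → EuclideanSpace ℝ (Fin 3) → EuclideanSpace ℝ (Fin 3) := fun j y => physWindowField T x₀ u (t (j + j₀)) y
    with hWdef
  have hW : ∀ (j : ℕ) (y : EuclideanSpace ℝ (Fin 3)), W j y =
      (σ * ν) • ((lam (j + j₀) / ν) • u (T + lam (j + j₀) ^ 2 * s / ν) (x₀ + lam (j + j₀) • (σ • y))) := by
    intro j y
    simp only [hWdef, physWindowField, hsq (j + j₀), smul_smul]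
    rw [ht (j + j₀)]
    congr 1
    field_simp
  have hconvW : ∀ y, Tendsto (fun j => W j y) atTop (𝓝 (profileWindowField ν v s y)) := by
    intro y
    have h := ((hconv s hs (σ • y)).comp hshift).const_smul (σ * ν)
    have h' : Tendsto (fun j => W j y) atTop (𝓝 ((σ * ν) • v s (σ • y))) := h.congr fun j => (hW j y).symm
    simpa only [profileWindowField, hσ] using h'
  have hmem : ∀ j, t (j + j₀) ∈ Set.Ico 0 T := fun j =>
    ⟨(hj₀ (j + j₀) (Nat.le_add_left _ _)).1.le, (hj₀ (j + j₀) (Nat.le_add_left _ _)).2⟩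
  have hWc : ∀ j, Continuous (W j) := fun j => by
    show Continuous fun y => physWindowField T x₀ u (t (j + j₀)) y
    exact ((hcl.contDiff_velocity (hmem j)).continuous.comp
      (continuous_const.add (continuous_const_smul _))).const_smul (Real.sqrt (T - t (j + j₀)))
  have hWfun : ∀ j, W j = physWindowField T x₀ u (t (j + j₀)) := fun j => rfl
  have hle : Φ (profileWindowField ν v s) ≤ liminf (fun j => Φ (W j)) atTop :=
    hlsc W (profileWindowField ν v s) hWc (continuous_profileWindowField hvs) hconvW
  have hsmallW : ∀ᶠ j in atTop, Φ (W j) ≤ ENNReal.ofReal ε := by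
    filter_upwards [hsmallj] with j hj
    simpa only [hWfun] using hj
  exact hle.trans (liminf_le_of_frequently_le' hsmallW.frequently)

/-- **K1(Φ) HOLDS for every zoom-closed `Φ`.** -/
theorem stratumZoom_of_lsc (hlsc : IsWindowLsc Φ) : StratumZoom Φ := by
  intro ν T hν hT u p hcl hLH hdec x₀ ρ M hρ hM hnot
  obtain ⟨C, v, lam, hlam, hlam0, ⟨hrate, hcont, hmild, hdiv⟩, hsing, hconv⟩ :=
    Summit.NavierStokesRegularity.NavierStokesRegularity.Theorems.LocalVelCompTubeDoorLocalPointZoomVelSlices.localPointZoomVelSlices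
      ν T hν hT u p hcl hLH hdec x₀ ρ M hρ
      (Summit.NavierStokesRegularity.NavierStokesRegularity.Theorems.PlaneStrainDoorZoomSpaceTimeDecay.timeTypeI_of_spaceTimeTypeI hM)
      hnot
  have hdecay : HasTypeIDecay (M / ν) v :=
    Summit.NavierStokesRegularity.NavierStokesRegularity.Theorems.PlaneStrainDoorZoomSpaceTimeDecay.hasTypeIDecay_of_zoom
      hν hT hρ hlam hlam0 hM hconv
  exact ⟨C, v, ⟨hrate, hcont, hmild, hdiv⟩, hdecay, hsing, fun ε hsmall s hs =>
    stratum_windowLimit hlsc hν hT hcl hlam hlam0 hconv hsmall hs (continuous_slice_of_continuousOn hcont hs)⟩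

/-- **The door from K1(Φ) and the residue R(Φ)** (generic logic). -/
theorem stratumDoorAt_of_residue {ν M : ℝ} (hν : 0 < ν) (h₁ : StratumZoom Φ)
    (h₂ : 0 < M / ν → StratumResidue Φ ν (M / ν)) : StratumDoorAt Φ ν M := by
  rcases le_or_gt (M / ν) 0 with hD | hD
  · refine ⟨1, one_pos, fun T hT u p hcl hLH hdec x₀ ρ hρ hM _ => ?_⟩
    by_contra hnot
    obtain ⟨C, v, _, hdecay, hsing, _⟩ := h₁ ν T hν hT u p hcl hLH hdec x₀ ρ M hρ hM hnot
    exact not_isBackwardSingularPoint_of_eq_zero (eq_zero_of_decay_nonpos hD hdecay) hsing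
  · obtain ⟨ε, hε, hres⟩ := h₂ hD
    refine ⟨ε, hε, fun T hT u p hcl hLH hdec x₀ ρ hρ hM hsmall => ?_⟩
    by_contra hnot
    obtain ⟨C, v, hcls, hdecay, hsing, hax⟩ := h₁ ν T hν hT u p hcl hLH hdec x₀ ρ M hρ hM hnot
    obtain ⟨hrate, hcont, hmild, hdiv⟩ := hcls
    have hmildcls : IsTypeIAncientMild C v := isTypeIAncientMild_of_class hrate hcont hmild hdiv
    obtain ⟨q, hclv⟩ :=
      Summit.NavierStokesRegularity.NavierStokesRegularity.Theorems.exists_isClassicalNSSolutionOn_Iio_of_isTypeIAncientMild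
        hmildcls
    exact not_isBackwardSingularPoint_of_eq_zero (hres v q hclv hdecay (hax ε hsmall)) hsing

/-- **THE SCHEMA THEOREM K-stab(Φ, 𝔖): a zoom-closed observable that spreads to a stratum with a Type-I Liouville theorem
is `ε`-STABLE.**  Proof = B0 normalisation + E1 extraction + E2 classical limit + E3 analytic slices (tree, S25) + (H1) on
the limit + (H2) below `−1/4` + time shift + (H3) + the normalised witness. -/
theorem stratumResidue_of_liouville {ν D : ℝ} (hD : 0 < D) (hlsc : IsWindowLsc Φ)
    (hspread : SpreadsTo Φ 𝔖 ν) (hLiou : StratumLiouville 𝔖 D) : StratumResidue Φ ν D := by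
  by_contra hbad
  have hbad' : ∀ ε : ℝ, 0 < ε → ∃ (u : ℝ → EuclideanSpace ℝ (Fin 3) → EuclideanSpace ℝ (Fin 3))
      (p : ℝ → EuclideanSpace ℝ (Fin 3) → ℝ), IsClassicalNSSolutionOn (Iio 0) 1 0 u p ∧ HasTypeIDecay D u ∧
      ProfSmall Φ ν ε u ∧ ∃ t < 0, ∃ x, u t x ≠ 0 := by
    by_contra hno
    push Not at hno
    obtain ⟨ε, hε, hall⟩ := hno
    exact hbad ⟨ε, hε, fun u p hcl hdec hsm t ht x => hall u p hcl hdec hsm t ht x⟩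
  have hT0 : (-1 : ℝ) < 0 := by norm_num
  obtain ⟨η, hη, R, hnorm⟩ := normalise hD hT0
  have hseq : ∀ n : ℕ, ∃ (w : ℝ → EuclideanSpace ℝ (Fin 3) → EuclideanSpace ℝ (Fin 3)) (q : ℝ → EuclideanSpace ℝ (Fin 3) → ℝ),
      IsClassicalNSSolutionOn (Iio 0) 1 0 w q ∧ HasTypeIDecay D w ∧
      ProfSmall Φ ν (1 / ((n : ℝ) + 1)) w ∧ ∃ z : EuclideanSpace ℝ (Fin 3), ‖z‖ ≤ R ∧ η ≤ ‖w (-1) z‖ := by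
    intro n
    obtain ⟨u, p, hcl, hdec, hsm, hnt⟩ := hbad' (1 / ((n : ℝ) + 1)) (by positivity)
    obtain ⟨lam, hlam, z, hz, hηz⟩ := hnorm u p hcl hdec hnt
    exact ⟨nsRescale lam u, nsRescalePressure lam p, isClassical_nsRescale hcl hlam, hasTypeIDecay_nsRescale hdec hlam,
      profSmall_nsRescale hsm hlam, z, hz, hηz⟩
  choose vn qn hcl hdec hsm zn hzn hηn using hseq
  obtain ⟨φ, v, hφ, hvc, hbw, hlu, hdecv, xbar, hxbar⟩ := extraction (T := -1) hD le_rfl hcl hdec hzn hηn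
  obtain ⟨q, hclv⟩ := classical_limit hD hvc hbw hdecv
  obtain ⟨hL, hD'⟩ := bounds_of_decay hD hdecv
  have han := analytic_slices_of_decay hclv hL hD'
  have hcc := tendsto_of_locUnif hlu strictMono_id
  have hpt : ∀ t < -(1 / 4 : ℝ), ∀ y, Tendsto (fun n => vn (φ n) t y) atTop (𝓝 (v t y)) := by
    intro t ht y
    have h := hcc t ht y (fun _ => t) (fun _ => y) tendsto_const_nhds tendsto_const_nhds
    simpa using h
  have hεn : Tendsto (fun n => 1 / (((φ n : ℕ) : ℝ) + 1)) atTop (𝓝 0) :=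
    (tendsto_one_div_add_atTop_nhds_zero_nat (𝕜 := ℝ)).comp hφ.tendsto_atTop
  have hslice : ∀ n, ∀ t < 0, Continuous (vn (φ n) t) := fun n t ht =>
    ((hcl (φ n)).contDiff_velocity (by exact ht)).continuous
  have hvslice : ∀ t : ℝ, Continuous (v t) := fun t => hvc.comp (Continuous.prodMk_right t)
  -- (H1) on the limit: `Φ = 0` on the window field of every slice below `-1/4`
  have hzero : ∀ s < -(1 / 4 : ℝ), Φ (profileWindowField ν v s) = 0 := by
    intro s hs
    have hs0 : s < 0 := by linarith
    have hle : Φ (profileWindowField ν v s) ≤ liminf (fun n => Φ (profileWindowField ν (vn (φ n)) s)) atTop :=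
      hlsc (fun n => profileWindowField ν (vn (φ n)) s) (profileWindowField ν v s)
        (fun n => continuous_profileWindowField (hslice n s hs0)) (continuous_profileWindowField (hvslice s))
        (fun y => (hpt s hs _).const_smul _)
    have hbound : ∀ᶠ n in atTop, Φ (profileWindowField ν (vn (φ n)) s) ≤ ENNReal.ofReal (1 / (((φ n : ℕ) : ℝ) + 1)) :=
      Eventually.of_forall fun n => hsm (φ n) s hs0
    have hε0 : liminf (fun n => ENNReal.ofReal (1 / (((φ n : ℕ) : ℝ) + 1))) atTop = 0 := by
      rw [(ENNReal.tendsto_ofReal hεn).liminf_eq, ENNReal.ofReal_zero]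
    exact le_antisymm ((hle.trans (liminf_le_liminf hbound)).trans hε0.le) bot_le
  -- (H2): every slice below `-1/4` lies in the stratum
  have hstrat : ∀ s < -(1 / 4 : ℝ), v s ∈ 𝔖 := fun s hs => hspread v s (by linarith) (han s hs) (hzero s hs)
  -- time shift and (H3)
  set V : ℝ → EuclideanSpace ℝ (Fin 3) → EuclideanSpace ℝ (Fin 3) := fun τ => v (τ + -(1 / 4 : ℝ)) with hV_def
  have hVcl : IsClassicalNSSolutionOn (Iio 0) 1 0 V (fun τ => q (τ + -(1 / 4 : ℝ))) := by
    have h1 := hclv.comp_add_right (-(1 / 4 : ℝ))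
    have hS : (fun τ : ℝ => τ + -(1 / 4 : ℝ)) ⁻¹' Iio (-(1 / 4 : ℝ)) = Iio 0 := by
      ext τ
      simp only [mem_preimage, mem_Iio]
      constructor <;> intro h <;> linarith
    rw [hS] at h1
    exact h1
  have hVdec : HasTypeIDecay D V := by
    intro τ hτ y
    have h1 := hdecv (τ + -(1 / 4 : ℝ)) (by linarith) y
    have hpos : 0 < ‖y‖ + Real.sqrt (-τ) := by
      have := Real.sqrt_pos.2 (neg_pos.2 hτ); positivity
    have hsqrt : Real.sqrt (-τ) ≤ Real.sqrt (-(τ + -(1 / 4 : ℝ))) := Real.sqrt_le_sqrt (by linarith)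
    calc ‖V τ y‖ = ‖v (τ + -(1 / 4 : ℝ)) y‖ := rfl
      _ ≤ D / (‖y‖ + Real.sqrt (-(τ + -(1 / 4 : ℝ)))) := h1
      _ ≤ D / (‖y‖ + Real.sqrt (-τ)) := div_le_div_of_nonneg_left hD.le hpos (by linarith)
  have hVstrat : ∀ τ < 0, V τ ∈ 𝔖 := fun τ hτ => hstrat (τ + -(1 / 4 : ℝ)) (by linarith)
  have hV0 := hLiou V _ hVcl hVdec hVstrat
  have h0 : v (-1) xbar = 0 := by
    have h := hV0 (-(3 / 4 : ℝ)) (by norm_num) xbar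
    simp only [hV_def] at h
    norm_num at h
    exact h
  have : η ≤ 0 := by simpa [h0] using hxbar
  exact absurd this (not_le.2 hη)

/-- **THE ε-DOOR OF A STRATUM (schema, PROVED):** (H1) + (H2) + (H3 for every `D > 0`) ⇒ the door at every `M`. -/
theorem stratumDoorAt_of_liouville {ν : ℝ} (hν : 0 < ν) (hlsc : IsWindowLsc Φ) (hspread : SpreadsTo Φ 𝔖 ν)
    (hLiou : ∀ D : ℝ, 0 < D → StratumLiouville 𝔖 D) (M : ℝ) : StratumDoorAt Φ ν M :=
  stratumDoorAt_of_residue hν (stratumZoom_of_lsc hlsc) fun hD =>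
    stratumResidue_of_liouville hD hlsc hspread (hLiou (M / ν) hD)

end Schema

end Summit.NavierStokesRegularity.NavierStokesRegularity.Theorems.StableStrataDoorSchema
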